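import Summits.HodgeConjecture.HodgeConjecture.Theorems.F0P3cStCharTSEllLin            -- ★ p848270∕p848283 (this seat): «ELL-LIN» (+ ★ «ELL-ALG» p848212, ★ carpet `Ch12Sec5Defs`)
import Literature.NumberTheory.Rogawski1990.Ch12Sec5                                   -- ★ TR carpet: `UpSpec`, `Prop1252`, `InnerGDefined`, `InnerHDefined` (named relations on the datum)
import Literature.NumberTheory.Rogawski1990.Ch12Sec6                                   -- ★ TR carpet: `Prop1261a`, `Prop1261b`, `IsEllipticPair`, `IsEllipticRep`
import Literature.NumberTheory.Rogawski1990.CMCharIdentityClauses                     -- ★ organ vocabulary: `OneDimAutRepH`, `xiLocalChar`, `Gqs`, `qsForm`, `charDist`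
import Literature.NumberTheory.Rogawski1990.LocalTransferExistence                     -- ★ `IsLocalDeltaTransferExists` ((T_v))
import Literature.NumberTheory.Rogawski1990.FinExplicitTransferFactorConjRight         -- ★ `finExplicitCollection`, `finExplicitDelta_conj_left_all∕right_all` (Δ‴_{Φ₃} of record)
import Literature.NumberTheory.Automorphic.OrbitalMeasureCanonical                     -- ★ `OrbitalMeasureFamily.IsCanonical`
import Literature.NumberTheory.Automorphic.UnitaryGroupPrincipalSeriesH                -- ★ `HLengthTwoLabels`
import Literature.NumberTheory.Automorphic.IrreducibleClassesUnitarizable              -- ★ `IrrClass.IsSquareIntegrable` cone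
import Mathlib.MeasureTheory.Function.LocallyIntegrable
import HarnessLib

/-!
# F0 · P3c · line LH6 «StCharTS» — «ELL-COMPOSE★»: organ (S-b1) `stub_StEllipticNormTwo` KERNEL-COMPOSED from the TR carpet relations read at a datum
# `𝔇 : EllipticData (U(Φ₃)_v, H_v)`, the printed inputs no carpet states (as binders), and ONE organ-internal input («no l.d.s. packet inside supp aX»)

Cell `pub/hodgecm-mathlib`, crux H413 = `stmt-HodgeConjecture-24833` (`--supports` lane, helper), route HCCMUnconditional; seat LH6-p01 (g0); desk F0P3b-plan (g23) DEAL
«ELL-COMPOSE★» 2026-09-02T03:07:39Z («the theorem's hypothesis list IS the exact named-print residue of the organ, kernel-checked»).  THEOREMS ONLY, sorry-free, no definition ∕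
instance ∕ notation ∕ named fact; the datum is a BINDER; nothing about `U(3)` is asserted.
HONEST LABEL: HC_CM is proved only modulo the 7 printed citations (2 remaining: hLiu418 = stmt-HodgeConjecture-24832, h413 = stmt-HodgeConjecture-24833)
until rung 0 closes; count-neutral — (S-b1) stays a printed row of the leaf `Cruxes/H413/Lines/F0_P3c_StCharTSPaydown.lean` ED. 1 (:203).

THE STATEMENT `stEllipticNormTwo_of_carpet` = the TREE TEXT of `stub_StEllipticNormTwo` (ED. 1 :203–246, `Pl`∕`HLoc` unfolded) with TWO insertions:
(A) after the organ's `μZ` binders, the block «∀ 𝔇 : EllipticData (Gqs L v) (H_v), COMPAT → CARPET → RESIDUE →» — it must sit INSIDE the organ's binders because the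
datum's carriers `Gqs L v`, `H_v` and its instance arguments (the organ's `letI` quotient σ-algebras, `MeasurableSpace (Gqs L v ⧸ Z)`) are bound there;
(B) after the organ's last hypothesis, ONE organ-internal antecedent «no l.d.s. `L`-packet of `𝔇` lies inside `supp aX`» — print obtains it on p. 192 (chunk p0184 L39 –
p0185 L8) through the standing assumption (γ) = Prop. 13.1.3 (c) (GLOBAL) inside the proof of L. 12.7.2, i.e. it is (S-a)'s business; as typed, (S-b1) is TRUE but
not derivable from datum-level facts alone: an l.d.s. pair `{π′, π″} ⊆ supp aX` with `a(π′) = a(π″)` is invisible to `⟨ , ⟩_e` (`⟨χ_{π′}+χ_{π″}, ·⟩_e = 0` on L² characters,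
Prop. 12.6.1 (c)) yet adds `2a(π′)²` to `Σ a²` — recorded for the desk's ED. 2 «split, not growth» (export the clause from (S-a), assume it in (S-b1)).
COMPAT: `𝔇.μG = νQv`, `𝔇.μH = νHv`, `𝔇.μGZ = μZ`, `𝔇.IsTransfer φ f^H ↔ IsLocalDeltaTransfer … Δ‴_{Φ₃} … f^H φ`, `{πSt} ∈ 𝔇.sqPacketsH` (print: `ρ = St_H(ξ_v) ∈ Π²(H)`, `Card(ρ) = 1`).
CARPET (★ named relations, hypotheses): `UpSpec` (α ↦ α^G, p. 183), `Prop1252` (`⟨α^G, α^G⟩_{G,e} = 2⟨α, α⟩_{H,e}`, p. 184), `Prop1261a∕b` (orthogonality relations, p. 188).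
RESIDUE (print-implicit, datum-level, NO carpet states them — posted as one-line typer asks): (M1) Harish-Chandra: for L² `π`, `χ_π` is a measurable, locally integrable
class function, locally constant on `G^r`, with `Tr π(φ) = ∫ φ·χ_π`; (M1H) the same for the packet characters `χ_ρ`, `ρ ∈ Π²(H)`, plus their stability on `H^r`, `H^e`;
(UPR) `χ_ρ^G` locally integrable and locally constant on `G^r` (L. 12.5.1); (DENS) two measurable locally integrable class functions, locally constant on `G^r`, with equal
integrals against every `C_c^∞` function agree `μT`-a.e. on every elliptic Cartan representative (the set of non-regular points of a torus is null); (L2D) `D_G·χ_π ∈ L²(T)`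
for L² `π` (print: `D_Gχ_π` bounded on `G^e`); (ELL) L² ⇒ elliptic (§12.6 p. 187: not of the form `i_G(χ)`); (DET)(PIN) `ψ∘det` and `πⁿ(ξ)` are not L² (§12.2); (M5)
`⟨χ_ρ, χ_ρ⟩_{H,e} = Card(ρ)` for `ρ ∈ Π²(H)` (Cor. 12.5.4 proof p. 186; p. 194 «= 2 Card(ρ)»); (DEF) the two inner products in Prop. 12.5.2 converge for `α = χ_ρ`.
PROOF: `⟨ , ⟩_e`-orthonormality of the members from (ELL)+`Prop1261a∕b`+(DET)(PIN)+(B); the (β)-identity, (T_v), (M1), (M1H), `UpSpec` and COMPAT give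
`∫ φ·(Σ aX χ_π) = ∫ φ·χ_ρ^G` for every `φ ∈ C_c^∞(U(Φ₃)_v)`; (DENS) turns it into an a.e. identity on the elliptic tori; `Prop1252` + (M5) + `Card = 1` give `⟨χ_ρ^G, χ_ρ^G⟩_e = 2`;
★ «ELL-LIN» `finsum_sq_eq_of_sum_ae_eq_of_innerG_eq` concludes.

## References
* [Rogawski1990] J. D. Rogawski, *Automorphic Representations of Unitary Groups in Three Variables*, Ann. of Math. Stud. 123 (1990): §12.7 Lemma 12.7.2 (proof) pp. 192–194
  (p. 194 first display «Σ a(π)² = ⟨χ^G_ρ, χ^G_ρ⟩_e = 2⟨χ_ρ, χ_ρ⟩_{H,e} = 2 Card(ρ)»); §12.5 pp. 182–186 (Weyl integration, `α^G`, L. 12.5.1, Prop. 12.5.2, Cor. 12.5.4);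
  §12.6 Prop. 12.6.1 p. 188; §12.2 pp. 173–174; §13.1 Prop. 13.1.3 (c) p. 199.
-/

set_option autoImplicit false
-- the mandated namespace has the single-problem summit's repeated segment (`HodgeConjecture.HodgeConjecture`)
set_option linter.dupNamespace false

noncomputable section

open NumberField IsDedekindDomain MeasureTheory MeasureTheory.Measure Filter Topology
open scoped Matrix MatrixGroups BigOperators
open Literature.NumberTheory.Rogawski1990 Literature.NumberTheory.Automorphic Literature.NumberTheory.Automorphic.UnitaryGroup
open Literature.NumberTheory.GaloisRepresentations

namespace Summit.HodgeConjecture.HodgeConjecture.Cruxes.H413.F0P3cStCharTSEllCompose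

open Literature.NumberTheory.Rogawski1990.Ch12Sec5

/-- **«ELL-COMPOSE★» — (S-b1) `stub_StEllipticNormTwo` from the carpet relations at a datum `𝔇`, the printed residue as binders, and «no l.d.s. packet inside `supp aX`».**
See the module docstring for the hypothesis census (COMPAT ∕ CARPET ∕ RESIDUE ∕ (B)) and the proof sketch.
[cite: Rogawski1990, §12.7 Lemma 12.7.2 (proof) p. 194; §12.5 Prop. 12.5.2 p. 184; §12.6 Prop. 12.6.1 p. 188; §12.5 p. 183] -/
theorem stEllipticNormTwo_of_carpet :
  ∀ (L : Type) [Field L] [NumberField L] [IsCMField L] (μ : HeckeCharacter L) (ξ : OneDimAutRepH L) (v : HeightOneSpectrum (𝓞 ↥(maximalRealSubfield L))),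
    (∀ w : PlacesOver L v, IsCMField.complexConj L • w.1 = w.1) → μ.IsUnitary →
    (∀ x : Literature.NumberTheory.GaloisRepresentations.ideleGroup ↥(maximalRealSubfield L),
      μ (AdeleRing.ideleBaseChange (↥(maximalRealSubfield L)) L x) = quadraticHeckeCharCM L x) →
    ∀ [MeasurableSpace ((UnitaryGroup.cmDatum L 2 (Matrix.of fun i j : Fin 2 => if i.val + j.val + 1 = 2 then (1 : L) else 0)).Local v × (UnitaryGroup.cmDatum L 1 (Matrix.of fun i j : Fin 1 => if i.val + j.val + 1 = 1 then (1 : L) else 0)).Local v)] [BorelSpace ((UnitaryGroup.cmDatum L 2 (Matrix.of fun i j : Fin 2 => if i.val + j.val + 1 = 2 then (1 : L) else 0)).Local v × (UnitaryGroup.cmDatum L 1 (Matrix.of fun i j : Fin 1 => if i.val + j.val + 1 = 1 then (1 : L) else 0)).Local v)] [MeasurableSpace (Gqs L v)] [BorelSpace (Gqs L v)]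
      (νHv : Measure ((UnitaryGroup.cmDatum L 2 (Matrix.of fun i j : Fin 2 => if i.val + j.val + 1 = 2 then (1 : L) else 0)).Local v × (UnitaryGroup.cmDatum L 1 (Matrix.of fun i j : Fin 1 => if i.val + j.val + 1 = 1 then (1 : L) else 0)).Local v)) (νQv : Measure (Gqs L v))
      [νHv.IsHaarMeasure] [νHv.IsMulRightInvariant] [νQv.IsHaarMeasure] [νQv.IsMulRightInvariant],
    letI : ∀ a : ((UnitaryGroup.cmDatum L 2 (Matrix.of fun i j : Fin 2 => if i.val + j.val + 1 = 2 then (1 : L) else 0)).Local v × (UnitaryGroup.cmDatum L 1 (Matrix.of fun i j : Fin 1 => if i.val + j.val + 1 = 1 then (1 : L) else 0)).Local v), MeasurableSpace (((UnitaryGroup.cmDatum L 2 (Matrix.of fun i j : Fin 2 => if i.val + j.val + 1 = 2 then (1 : L) else 0)).Local v × (UnitaryGroup.cmDatum L 1 (Matrix.of fun i j : Fin 1 => if i.val + j.val + 1 = 1 then (1 : L) else 0)).Local v) ⧸ Subgroup.centralizer ({a} : Set ((UnitaryGroup.cmDatum L 2 (Matrix.of fun i j : Fin 2 => if i.val + j.val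 + 1 = 2 then (1 : L) else 0)).Local v × (UnitaryGroup.cmDatum L 1 (Matrix.of fun i j : Fin 1 => if i.val + j.val + 1 = 1 then (1 : L) else 0)).Local v))) := fun _ => borel _
    haveI : ∀ a : ((UnitaryGroup.cmDatum L 2 (Matrix.of fun i j : Fin 2 => if i.val + j.val + 1 = 2 then (1 : L) else 0)).Local v × (UnitaryGroup.cmDatum L 1 (Matrix.of fun i j : Fin 1 => if i.val + j.val + 1 = 1 then (1 : L) else 0)).Local v), BorelSpace (((UnitaryGroup.cmDatum L 2 (Matrix.of fun i j : Fin 2 => if i.val + j.val + 1 = 2 then (1 : L) else 0)).Local v × (UnitaryGroup.cmDatum L 1 (Matrix.of fun i j : Fin 1 => if i.val + j.val + 1 = 1 then (1 : L) else 0)).Local v) ⧸ Subgroup.centralizer ({a} : Set ((UnitaryGroup.cmDatum L 2 (Matrix.of fun i j : Fin 2 => if i.val + j.val + 1 = 2 then (1 : L) else 0)).Local v × (UnitaryGroup.cmDatum L 1 (Matrix.of fun i j : Fin 1 => if i.val + j.val + 1 = 1 then (1 : L) else 0)).Local v))) := fun _ => ⟨rfl⟩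
    letI : ∀ γ : Gqs L v, MeasurableSpace (Gqs L v ⧸ Subgroup.centralizer ({γ} : Set (Gqs L v))) := fun _ => borel _
    haveI : ∀ γ : Gqs L v, BorelSpace (Gqs L v ⧸ Subgroup.centralizer ({γ} : Set (Gqs L v))) := fun _ => ⟨rfl⟩
    ∀ (mHv : OrbitalMeasureFamily ((UnitaryGroup.cmDatum L 2 (Matrix.of fun i j : Fin 2 => if i.val + j.val + 1 = 2 then (1 : L) else 0)).Local v × (UnitaryGroup.cmDatum L 1 (Matrix.of fun i j : Fin 1 => if i.val + j.val + 1 = 1 then (1 : L) else 0)).Local v)) (mQv : OrbitalMeasureFamily (Gqs L v)),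
      mHv.IsCanonical (IsLocalGRegular L v) νHv →
      mQv.IsCanonical (fun γ => IsRegularElt (γ.val : GL (Fin 3) (UnitaryGroup.LocalRing L v))) νQv →
      IsLocalDeltaTransferExists L (qsForm L) v ((finExplicitCollection L (qsForm L) μ (finExplicitDelta_conj_left_all L (qsForm L) μ) (finExplicitDelta_conj_right_all L (qsForm L) μ)) v) mHv mQv IsLocSmooth IsLocSmooth →
      ∀ (π₁ πSt : IrrClass ((UnitaryGroup.cmDatum L 2 (Matrix.of fun i j : Fin 2 => if i.val + j.val + 1 = 2 then (1 : L) else 0)).Local v × (UnitaryGroup.cmDatum L 1 (Matrix.of fun i j : Fin 1 => if i.val + j.val + 1 = 1 then (1 : L) else 0)).Local v)),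
        HLengthTwoLabels L v
          (torusCharPair (conjLocal L (IsCMField.complexConj L) v) (cmLocalForm L 2 v) (cmLocalForm_eq_over L 2 v) 0
            ((torusLocalComponent L (IsCMField.complexConj L) v ξ.η).comp
                (quotConj (conjLocal L (IsCMField.complexConj L) v) (conjLocal_conjLocal_cm L v)) *
              halfModulusChar (UnitaryGroup.LocalRing L v))
            (torusLocalComponent L (IsCMField.complexConj L) v ξ.ψ))
          ((torusLocalComponent L (IsCMField.complexConj L) v ξ.ψ).comp (localDet (IsCMField.complexConj L) v (isUnit_antidiagOne_det L 1))) π₁ πSt →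
        (∀ fH : ((UnitaryGroup.cmDatum L 2 (Matrix.of fun i j : Fin 2 => if i.val + j.val + 1 = 2 then (1 : L) else 0)).Local v × (UnitaryGroup.cmDatum L 1 (Matrix.of fun i j : Fin 1 => if i.val + j.val + 1 = 1 then (1 : L) else 0)).Local v) → ℂ, IsLocSmooth fH → π₁.smoothTrace νHv fH = charDist (ξ.xiLocalChar v) νHv fH) →
      ∀ [MeasurableSpace (Gqs L v ⧸ Subgroup.center (Gqs L v))] [BorelSpace (Gqs L v ⧸ Subgroup.center (Gqs L v))]
        (μZ : Measure (Gqs L v ⧸ Subgroup.center (Gqs L v))) [μZ.IsHaarMeasure],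
      -- ══ the §12.5–12.6 DATUM on the model (★ TR carpet `Ch12Sec5Defs.EllipticData`, a BINDER — no instance) and its COMPATIBILITY with the organ's currency ══
      ∀ (𝔇 : Ch12Sec5.EllipticData (Gqs L v) ((UnitaryGroup.cmDatum L 2 (Matrix.of fun i j : Fin 2 => if i.val + j.val + 1 = 2 then (1 : L) else 0)).Local v × (UnitaryGroup.cmDatum L 1 (Matrix.of fun i j : Fin 1 => if i.val + j.val + 1 = 1 then (1 : L) else 0)).Local v)),
      𝔇.μG = νQv → 𝔇.μH = νHv → 𝔇.μGZ = μZ →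
      (∀ (φ : Gqs L v → ℂ) (fH : ((UnitaryGroup.cmDatum L 2 (Matrix.of fun i j : Fin 2 => if i.val + j.val + 1 = 2 then (1 : L) else 0)).Local v × (UnitaryGroup.cmDatum L 1 (Matrix.of fun i j : Fin 1 => if i.val + j.val + 1 = 1 then (1 : L) else 0)).Local v) → ℂ), 𝔇.IsTransfer φ fH ↔ IsLocalDeltaTransfer L (qsForm L) v ((finExplicitCollection L (qsForm L) μ (finExplicitDelta_conj_left_all L (qsForm L) μ) (finExplicitDelta_conj_right_all L (qsForm L) μ)) v) mHv mQv fH φ) →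
      ({πSt} : Finset (IrrClass ((UnitaryGroup.cmDatum L 2 (Matrix.of fun i j : Fin 2 => if i.val + j.val + 1 = 2 then (1 : L) else 0)).Local v × (UnitaryGroup.cmDatum L 1 (Matrix.of fun i j : Fin 1 => if i.val + j.val + 1 = 1 then (1 : L) else 0)).Local v))) ∈ 𝔇.sqPacketsH →
      -- ══ CARPET RELATIONS (named facts of ★ `Ch12Sec5` ∕ ★ `Ch12Sec6`, read at `𝔇`) ══
      𝔇.UpSpec → 𝔇.Prop1252 → Ch12Sec6.Prop1261a 𝔇 → Ch12Sec6.Prop1261b 𝔇 →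
      -- ══ PRINTED INPUTS NO CARPET STATES (datum-level; typer asks (M1)(M1H)(UPR)(DENS)(L2D)(ELL)(DET)(PIN)(M5)(DEF)) ══
      (∀ π : IrrClass (Gqs L v), 𝔇.IsL2 π → Measurable (𝔇.char π) ∧ LocallyIntegrable (𝔇.char π) 𝔇.μG ∧
          (∀ x ∈ 𝔇.regG, ∀ᶠ y in 𝓝 x, 𝔇.char π y = 𝔇.char π x) ∧
          ∀ φ : Gqs L v → ℂ, IsLocSmooth φ → π.smoothTrace 𝔇.μG φ = ∫ x, φ x * 𝔇.char π x ∂𝔇.μG) →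
      (∀ ρ ∈ 𝔇.sqPacketsH, Measurable (𝔇.packetCharH ρ) ∧ LocallyIntegrable (𝔇.packetCharH ρ) 𝔇.μH ∧
          Ch12Sec5.IsStableClassFunOn 𝔇.stConjH 𝔇.regH (𝔇.packetCharH ρ) ∧ Ch12Sec5.IsStableClassFunOn 𝔇.stConjH 𝔇.ellH (𝔇.packetCharH ρ) ∧
          ∀ fH : ((UnitaryGroup.cmDatum L 2 (Matrix.of fun i j : Fin 2 => if i.val + j.val + 1 = 2 then (1 : L) else 0)).Local v × (UnitaryGroup.cmDatum L 1 (Matrix.of fun i j : Fin 1 => if i.val + j.val + 1 = 1 then (1 : L) else 0)).Local v) → ℂ, IsLocSmooth fH → (∑ σ ∈ ρ, σ.smoothTrace 𝔇.μH fH) = ∫ h, fH h * 𝔇.packetCharH ρ h ∂𝔇.μH) →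
      (∀ ρ ∈ 𝔇.sqPacketsH, LocallyIntegrable (𝔇.up (𝔇.packetCharH ρ)) 𝔇.μG ∧
          ∀ x ∈ 𝔇.regG, ∀ᶠ y in 𝓝 x, 𝔇.up (𝔇.packetCharH ρ) y = 𝔇.up (𝔇.packetCharH ρ) x) →
      (∀ F U : Gqs L v → ℂ, Measurable F → Measurable U → LocallyIntegrable F 𝔇.μG → LocallyIntegrable U 𝔇.μG →
          (∀ x ∈ 𝔇.regG, ∀ᶠ y in 𝓝 x, F y = F x) → (∀ x ∈ 𝔇.regG, ∀ᶠ y in 𝓝 x, U y = U x) →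
          (∀ φ : Gqs L v → ℂ, IsLocSmooth φ → ∫ x, φ x * F x ∂𝔇.μG = ∫ x, φ x * U x ∂𝔇.μG) →
          ∀ T ∈ 𝔇.cartanG, ∀ᵐ t : ↥T ∂(𝔇.μT T), F (t : Gqs L v) = U (t : Gqs L v)) →
      (∀ π : IrrClass (Gqs L v), 𝔇.IsL2 π → ∀ T ∈ 𝔇.cartanG, MemLp (fun t : ↥T => (𝔇.DG (t : Gqs L v) : ℂ) * 𝔇.char π (t : Gqs L v)) 2 (𝔇.μT T)) →
      (∀ π : IrrClass (Gqs L v), 𝔇.IsL2 π → 𝔇.IsEllipticRep π) →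
      (∀ ψ : ↥(Subgroup.center (Gqs L v)) →* ℂˣ, Continuous ψ → ¬ 𝔇.IsL2 (𝔇.detG ψ)) →
      (∀ ξ' : ((UnitaryGroup.cmDatum L 2 (Matrix.of fun i j : Fin 2 => if i.val + j.val + 1 = 2 then (1 : L) else 0)).Local v × (UnitaryGroup.cmDatum L 1 (Matrix.of fun i j : Fin 1 => if i.val + j.val + 1 = 1 then (1 : L) else 0)).Local v) →* ℂˣ, Continuous ξ' → ¬ 𝔇.IsL2 (𝔇.piN ξ')) →
      (∀ ρ ∈ 𝔇.sqPacketsH, 𝔇.innerH (𝔇.packetCharH ρ) (𝔇.packetCharH ρ) = (ρ.card : ℂ)) →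
      (∀ ρ ∈ 𝔇.sqPacketsH, 𝔇.InnerGDefined (𝔇.up (𝔇.packetCharH ρ)) (𝔇.up (𝔇.packetCharH ρ)) ∧ 𝔇.InnerHDefined (𝔇.packetCharH ρ) (𝔇.packetCharH ρ)) →
      ∀ aX : IrrClass (Gqs L v) → ℤ,
        (∀ (fH : ((UnitaryGroup.cmDatum L 2 (Matrix.of fun i j : Fin 2 => if i.val + j.val + 1 = 2 then (1 : L) else 0)).Local v × (UnitaryGroup.cmDatum L 1 (Matrix.of fun i j : Fin 1 => if i.val + j.val + 1 = 1 then (1 : L) else 0)).Local v) → ℂ) (φ : Gqs L v → ℂ), IsLocSmooth fH → IsLocSmooth φ →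
            IsLocalDeltaTransfer L (qsForm L) v ((finExplicitCollection L (qsForm L) μ (finExplicitDelta_conj_left_all L (qsForm L) μ) (finExplicitDelta_conj_right_all L (qsForm L) μ)) v) mHv mQv fH φ →
            Summable (fun π : IrrClass (Gqs L v) => (aX π : ℂ) * π.smoothTrace νQv φ) ∧
              ∑' π : IrrClass (Gqs L v), (aX π : ℂ) * π.smoothTrace νQv φ = πSt.smoothTrace νHv fH) →
        (Function.support aX).Finite →
        (∀ π : IrrClass (Gqs L v), aX π ≠ 0 → π.IsSquareIntegrable μZ) →
        -- ══ the ONE organ-internal input: no l.d.s. L-packet inside `supp aX` ((S-a)'s export; print p. 192 via (γ) = Prop. 13.1.3 (c)) ══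
        (∀ P ∈ 𝔇.ldsPackets, ∀ π ∈ P, ∀ π' ∈ P, π ≠ π' → aX π = 0 ∨ aX π' = 0) →
        ∑ᶠ π : IrrClass (Gqs L v), aX π ^ 2 = 2 := by
  intro L _ _ _ μ ξ v hns hμu hμω _ _ _ _ νHv νQv _ _ _ _ mHv mQv hcanH hcanQ hTv π₁ πSt hHL hπ₁ _ _ μZ _
    𝔇 hμG hμH hμGZ hTr hρ hUp h52 h61a h61b hHC hHCH hUpReg hDens hL2dom hEll hDet hPiN hM5 hDef
    aX hid hfin hL2 hlds
  classical
  -- (0) the organ's quotient σ-algebras, re-installed as local instances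
  letI : ∀ a' : ((UnitaryGroup.cmDatum L 2 (Matrix.of fun i j : Fin 2 => if i.val + j.val + 1 = 2 then (1 : L) else 0)).Local v × (UnitaryGroup.cmDatum L 1 (Matrix.of fun i j : Fin 1 => if i.val + j.val + 1 = 1 then (1 : L) else 0)).Local v), MeasurableSpace (((UnitaryGroup.cmDatum L 2 (Matrix.of fun i j : Fin 2 => if i.val + j.val + 1 = 2 then (1 : L) else 0)).Local v × (UnitaryGroup.cmDatum L 1 (Matrix.of fun i j : Fin 1 => if i.val + j.val + 1 = 1 then (1 : L) else 0)).Local v) ⧸ Subgroup.centralizer ({a'} : Set ((UnitaryGroup.cmDatum L 2 (Matrix.of fun i j : Fin 2 => if i.val + j.val + 1 = 2 then (1 : L) else 0)).Local v × (UnitaryGroup.cmDatum L 1 (Matrix.of fun i j : Fin 1 => if i.val + j.val + 1 = 1 then (1 : L) else 0)).Local v))) := fun _ => borel _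
  haveI : ∀ a' : ((UnitaryGroup.cmDatum L 2 (Matrix.of fun i j : Fin 2 => if i.val + j.val + 1 = 2 then (1 : L) else 0)).Local v × (UnitaryGroup.cmDatum L 1 (Matrix.of fun i j : Fin 1 => if i.val + j.val + 1 = 1 then (1 : L) else 0)).Local v), BorelSpace (((UnitaryGroup.cmDatum L 2 (Matrix.of fun i j : Fin 2 => if i.val + j.val + 1 = 2 then (1 : L) else 0)).Local v × (UnitaryGroup.cmDatum L 1 (Matrix.of fun i j : Fin 1 => if i.val + j.val + 1 = 1 then (1 : L) else 0)).Local v) ⧸ Subgroup.centralizer ({a'} : Set ((UnitaryGroup.cmDatum L 2 (Matrix.of fun i j : Fin 2 => if i.val + j.val + 1 = 2 then (1 : L) else 0)).Local v × (UnitaryGroup.cmDatum L 1 (Matrix.of fun i j : Fin 1 => if i.val + j.val + 1 = 1 then (1 : L) else 0)).Local v))) := fun _ => ⟨rfl⟩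
  letI : ∀ γ : Gqs L v, MeasurableSpace (Gqs L v ⧸ Subgroup.centralizer ({γ} : Set (Gqs L v))) := fun _ => borel _
  haveI : ∀ γ : Gqs L v, BorelSpace (Gqs L v ⧸ Subgroup.centralizer ({γ} : Set (Gqs L v))) := fun _ => ⟨rfl⟩
  set S : Finset (IrrClass (Gqs L v)) := hfin.toFinset with hS
  have hmemS : ∀ π, π ∈ S ↔ aX π ≠ 0 := fun π => by rw [hS, Set.Finite.mem_toFinset, Function.mem_support]
  -- (1) the members are square-integrable for the datum, hence elliptic; the packet `ρ = {πSt}`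
  have hL2' : ∀ π ∈ S, 𝔇.IsL2 π := fun π hπ => by
    show IrrClass.IsSquareIntegrable 𝔇.μGZ π
    rw [hμGZ]
    exact hL2 π ((hmemS π).1 hπ)
  set α : ((UnitaryGroup.cmDatum L 2 (Matrix.of fun i j : Fin 2 => if i.val + j.val + 1 = 2 then (1 : L) else 0)).Local v × (UnitaryGroup.cmDatum L 1 (Matrix.of fun i j : Fin 1 => if i.val + j.val + 1 = 1 then (1 : L) else 0)).Local v) → ℂ := 𝔇.packetCharH {πSt} with hα
  obtain ⟨hαm, hαli, hαst, hαste, hαtr⟩ := hHCH _ hρ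
  obtain ⟨hUli, hUlc⟩ := hUpReg _ hρ
  obtain ⟨hUm, -, hUint⟩ := hUp α hαm hαst
  -- (2) orthonormality of the members for `⟨ , ⟩_{G,e}` [Prop. 12.6.1 (a)(b) + (ELL) + (DET)(PIN) + (B)]
  have horth : ∀ i ∈ S, ∀ j ∈ S, 𝔇.innerG (𝔇.char i) (𝔇.char j) = if i = j then 1 else 0 := by
    intro i hi j hj
    by_cases hij : i = j
    · subst hij
      rw [if_pos rfl]
      exact (h61a i (hEll i (hL2' i hi))).2 (hL2' i hi)
    · rw [if_neg hij]
      by_contra h0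
      have hpair := h61b i j (hEll i (hL2' i hi)) (hEll j (hL2' j hj)) h0 hij
      rcases hpair with ⟨P, hP, hPij⟩ | ⟨ψ, hψ, hψ'⟩ | ⟨ξ', hξ', hξ''⟩
      · have hiP : i ∈ P := (hPij i).2 (Or.inl rfl)
        have hjP : j ∈ P := (hPij j).2 (Or.inr rfl)
        rcases hlds P hP i hiP j hjP hij with h | h
        · exact (hmemS i).1 hi h
        · exact (hmemS j).1 hj h
      · rcases hψ' with ⟨-, hjd⟩ | ⟨hid', -⟩
        · exact hDet ψ hψ (hjd ▸ hL2' j hj)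
        · exact hDet ψ hψ (hid' ▸ hL2' i hi)
      · rcases hξ'' with ⟨-, hjn⟩ | ⟨hin, -⟩
        · exact hPiN ξ' hξ' (hjn ▸ hL2' j hj)
        · exact hPiN ξ' hξ' (hin ▸ hL2' i hi)
  -- (3) the `L²(D_G)` domain [(L2D)]
  have hχ : ∀ i ∈ S, ∀ T ∈ 𝔇.cartanG, MemLp (fun t : ↥T => (𝔇.DG (t : Gqs L v) : ℂ) * 𝔇.char i (t : Gqs L v)) 2 (𝔇.μT T) :=
    fun i hi => hL2dom i (hL2' i hi)
  -- (4) FUN: `Σ aX χ_π = χ_ρ^G` against every test function, then a.e. on the elliptic tori [(β), (T_v), (M1), (M1H), UpSpec, COMPAT, (DENS)]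
  set F : Gqs L v → ℂ := fun x => ∑ i ∈ S, (aX i : ℂ) * 𝔇.char i x with hF
  set U : Gqs L v → ℂ := 𝔇.up α with hU
  have hFm : Measurable F := Finset.measurable_sum S fun i hi => ((hHC i (hL2' i hi)).1).const_mul _
  have hFli : LocallyIntegrable F 𝔇.μG :=
    locallyIntegrable_finsetSum S fun i hi => ((hHC i (hL2' i hi)).2.1).smul (aX i : ℂ)
  have hFlc : ∀ x ∈ 𝔇.regG, ∀ᶠ y in 𝓝 x, F y = F x := by
    intro x hx
    have hall : ∀ᶠ y in 𝓝 x, ∀ i ∈ S, 𝔇.char i y = 𝔇.char i x :=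
      (Finset.eventually_all S).2 fun i hi => (hHC i (hL2' i hi)).2.2.1 x hx
    exact hall.mono fun y hy => Finset.sum_congr rfl fun i hi => by rw [hy i hi]
  have hint : ∀ φ : Gqs L v → ℂ, IsLocSmooth φ → ∫ x, φ x * F x ∂𝔇.μG = ∫ x, φ x * U x ∂𝔇.μG := by
    intro φ hφ
    -- a transfer `f^H` of `φ` [(T_v)], and the (β)-identity at `(f^H, φ)`
    obtain ⟨fH, hfH, hm⟩ := hTv φ hφ
    obtain ⟨-, hsum⟩ := hid fH φ hfH hφ hm
    -- the `tsum` is the finite sum over `S`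
    have htsum : ∑' π : IrrClass (Gqs L v), (aX π : ℂ) * π.smoothTrace νQv φ = ∑ π ∈ S, (aX π : ℂ) * π.smoothTrace νQv φ :=
      tsum_eq_sum fun π hπ => by rw [show aX π = 0 from not_not.1 fun h => hπ ((hmemS π).2 h), Int.cast_zero, zero_mul]
    -- each member trace is `∫ φ χ_π` [(M1)], the packet trace is `∫ f^H χ_ρ` [(M1H)]
    have hG : ∑ π ∈ S, (aX π : ℂ) * π.smoothTrace νQv φ = ∫ x, φ x * F x ∂𝔇.μG := by
      rw [← hμG]
      have hterm : ∀ π ∈ S, Integrable (fun x => φ x * 𝔇.char π x) 𝔇.μG := fun π hπ =>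
        ((hHC π (hL2' π hπ)).2.1).integrable_smul_left_of_hasCompactSupport hφ.continuous hφ.hasCompactSupport
      have hexp : (fun x => φ x * F x) = fun x => ∑ π ∈ S, (aX π : ℂ) * (φ x * 𝔇.char π x) := by
        funext x
        simp only [hF, Finset.mul_sum]
        refine Finset.sum_congr rfl fun π _ => ?_
        ring
      rw [hexp, integral_finsetSum S fun π hπ => (hterm π hπ).const_mul _]
      refine Finset.sum_congr rfl fun π hπ => ?_
      rw [integral_const_mul, (hHC π (hL2' π hπ)).2.2.2 φ hφ]
    have hH : πSt.smoothTrace νHv fH = ∫ h, fH h * α h ∂𝔇.μH := by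
      rw [← hμH, ← hαtr fH hfH, Finset.sum_singleton]
    -- `UpSpec` at `α = χ_ρ`: `∫ φ·α^G dg = ∫ f^H·α dh`
    have hIφU : Integrable (fun x => φ x * U x) 𝔇.μG :=
      hUli.integrable_smul_left_of_hasCompactSupport hφ.continuous hφ.hasCompactSupport
    have hIfα : Integrable (fun h => fH h * α h) 𝔇.μH :=
      hαli.integrable_smul_left_of_hasCompactSupport hfH.continuous hfH.hasCompactSupport
    have hup := hUint φ ⟨hφ.1, hφ.2⟩ fH ((hTr φ fH).2 hm) hIφU hIfα
    rw [← hG, ← htsum, hsum, hH, ← hup]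
  have hψ : ∀ T ∈ 𝔇.cartanG, ∀ᵐ t : ↥T ∂(𝔇.μT T), (∑ i ∈ S, (aX i : ℂ) • 𝔇.char i) (t : Gqs L v) = U (t : Gqs L v) := by
    intro T hT
    have hae := hDens F U hFm hUm hFli hUli hFlc hUlc hint T hT
    refine hae.mono fun t ht => ?_
    rw [← ht, hF, Finset.sum_apply]
    refine Finset.sum_congr rfl fun i _ => ?_
    rw [Pi.smul_apply, smul_eq_mul]
  -- (5) NORM: `⟨χ_ρ^G, χ_ρ^G⟩_e = 2⟨χ_ρ, χ_ρ⟩_{H,e} = 2·Card(ρ) = 2` [Prop. 12.5.2, (M5)]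
  have hn : 𝔇.innerG U U = ((2 : ℤ) : ℂ) := by
    obtain ⟨hdG, hdH⟩ := hDef _ hρ
    rw [hU, hα, h52 _ _ hαm hαm hαste hαste hdG hdH, hM5 _ hρ, Finset.card_singleton]
    push_cast
    ring
  -- (6) ★ «ELL-LIN»: `Σ aX² = n` from orthonormality, the a.e. identity and the norm
  exact F0P3cStCharTSEllLin.finsum_sq_eq_of_sum_ae_eq_of_innerG_eq 𝔇 aX hfin 𝔇.char hχ horth U hψ 2 hn

/-! ## ED. 2 (desk F0P3b-plan (g23) ruling 03:16:32Z): the organ-internal antecedent (B) is DISCHARGED by (S-b1)'s own «members are L²» hypothesis and the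
datum-level print fact (LDS) «l.d.s. packet members are not square-integrable» [Rogawski1990 §12.2 p. 174 case (3): the constituents of the unitary principal
series `i_G(θ̃)`, `θ` semi-regular, are tempered, not square-integrable] — so the conclusion below is the (S-b1) organ text VERBATIM after the datum block. -/

/-- **«ELL-COMPOSE★» ED. 2 — (S-b1) `stub_StEllipticNormTwo` VERBATIM (no organ-internal antecedent) from the carpet relations at a datum `𝔇`, the ten printed
residue binders of ED. 1 and the eleventh (LDS) «`∀ P ∈ 𝔇.ldsPackets, ∀ σ ∈ P, ¬ 𝔇.IsL2 σ`».**  Proof: ED. 1 `stEllipticNormTwo_of_carpet`, its antecedent (B)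
derived in two lines from the organ's `(∀ π, aX π ≠ 0 → π.IsSquareIntegrable μZ)`, `𝔇.μGZ = μZ` and (LDS).
[cite: Rogawski1990, §12.7 Lemma 12.7.2 (proof) p. 194; §12.2 p. 174; §12.5 Prop. 12.5.2 p. 184; §12.6 Prop. 12.6.1 p. 188] -/
theorem stEllipticNormTwo_of_carpet_of_lds_not_L2 :
  ∀ (L : Type) [Field L] [NumberField L] [IsCMField L] (μ : HeckeCharacter L) (ξ : OneDimAutRepH L) (v : HeightOneSpectrum (𝓞 ↥(maximalRealSubfield L))),
    (∀ w : PlacesOver L v, IsCMField.complexConj L • w.1 = w.1) → μ.IsUnitary →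
    (∀ x : Literature.NumberTheory.GaloisRepresentations.ideleGroup ↥(maximalRealSubfield L),
      μ (AdeleRing.ideleBaseChange (↥(maximalRealSubfield L)) L x) = quadraticHeckeCharCM L x) →
    ∀ [MeasurableSpace ((UnitaryGroup.cmDatum L 2 (Matrix.of fun i j : Fin 2 => if i.val + j.val + 1 = 2 then (1 : L) else 0)).Local v × (UnitaryGroup.cmDatum L 1 (Matrix.of fun i j : Fin 1 => if i.val + j.val + 1 = 1 then (1 : L) else 0)).Local v)] [BorelSpace ((UnitaryGroup.cmDatum L 2 (Matrix.of fun i j : Fin 2 => if i.val + j.val + 1 = 2 then (1 : L) else 0)).Local v × (UnitaryGroup.cmDatum L 1 (Matrix.of fun i j : Fin 1 => if i.val + j.val + 1 = 1 then (1 : L) else 0)).Local v)] [MeasurableSpace (Gqs L v)] [BorelSpace (Gqs L v)]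
      (νHv : Measure ((UnitaryGroup.cmDatum L 2 (Matrix.of fun i j : Fin 2 => if i.val + j.val + 1 = 2 then (1 : L) else 0)).Local v × (UnitaryGroup.cmDatum L 1 (Matrix.of fun i j : Fin 1 => if i.val + j.val + 1 = 1 then (1 : L) else 0)).Local v)) (νQv : Measure (Gqs L v))
      [νHv.IsHaarMeasure] [νHv.IsMulRightInvariant] [νQv.IsHaarMeasure] [νQv.IsMulRightInvariant],
    letI : ∀ a : ((UnitaryGroup.cmDatum L 2 (Matrix.of fun i j : Fin 2 => if i.val + j.val + 1 = 2 then (1 : L) else 0)).Local v × (UnitaryGroup.cmDatum L 1 (Matrix.of fun i j : Fin 1 => if i.val + j.val + 1 = 1 then (1 : L) else 0)).Local v), MeasurableSpace (((UnitaryGroup.cmDatum L 2 (Matrix.of fun i j : Fin 2 => if i.val + j.val + 1 = 2 then (1 : L) else 0)).Local v × (UnitaryGroup.cmDatum L 1 (Matrix.of fun i j : Fin 1 => if i.val + j.val + 1 = 1 then (1 : L) else 0)).Local v) ⧸ Subgroup.centralizer ({a} : Set ((UnitaryGroup.cmDatum L 2 (Matrix.of fun i j : Fin 2 => if i.val + j.val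 + 1 = 2 then (1 : L) else 0)).Local v × (UnitaryGroup.cmDatum L 1 (Matrix.of fun i j : Fin 1 => if i.val + j.val + 1 = 1 then (1 : L) else 0)).Local v))) := fun _ => borel _
    haveI : ∀ a : ((UnitaryGroup.cmDatum L 2 (Matrix.of fun i j : Fin 2 => if i.val + j.val + 1 = 2 then (1 : L) else 0)).Local v × (UnitaryGroup.cmDatum L 1 (Matrix.of fun i j : Fin 1 => if i.val + j.val + 1 = 1 then (1 : L) else 0)).Local v), BorelSpace (((UnitaryGroup.cmDatum L 2 (Matrix.of fun i j : Fin 2 => if i.val + j.val + 1 = 2 then (1 : L) else 0)).Local v × (UnitaryGroup.cmDatum L 1 (Matrix.of fun i j : Fin 1 => if i.val + j.val + 1 = 1 then (1 : L) else 0)).Local v) ⧸ Subgroup.centralizer ({a} : Set ((UnitaryGroup.cmDatum L 2 (Matrix.of fun i j : Fin 2 => if i.val + j.val + 1 = 2 then (1 : L) else 0)).Local v × (UnitaryGroup.cmDatum L 1 (Matrix.of fun i j : Fin 1 => if i.val + j.val + 1 = 1 then (1 : L) else 0)).Local v))) := fun _ => ⟨rfl⟩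
    letI : ∀ γ : Gqs L v, MeasurableSpace (Gqs L v ⧸ Subgroup.centralizer ({γ} : Set (Gqs L v))) := fun _ => borel _
    haveI : ∀ γ : Gqs L v, BorelSpace (Gqs L v ⧸ Subgroup.centralizer ({γ} : Set (Gqs L v))) := fun _ => ⟨rfl⟩
    ∀ (mHv : OrbitalMeasureFamily ((UnitaryGroup.cmDatum L 2 (Matrix.of fun i j : Fin 2 => if i.val + j.val + 1 = 2 then (1 : L) else 0)).Local v × (UnitaryGroup.cmDatum L 1 (Matrix.of fun i j : Fin 1 => if i.val + j.val + 1 = 1 then (1 : L) else 0)).Local v)) (mQv : OrbitalMeasureFamily (Gqs L v)),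
      mHv.IsCanonical (IsLocalGRegular L v) νHv →
      mQv.IsCanonical (fun γ => IsRegularElt (γ.val : GL (Fin 3) (UnitaryGroup.LocalRing L v))) νQv →
      IsLocalDeltaTransferExists L (qsForm L) v ((finExplicitCollection L (qsForm L) μ (finExplicitDelta_conj_left_all L (qsForm L) μ) (finExplicitDelta_conj_right_all L (qsForm L) μ)) v) mHv mQv IsLocSmooth IsLocSmooth →
      ∀ (π₁ πSt : IrrClass ((UnitaryGroup.cmDatum L 2 (Matrix.of fun i j : Fin 2 => if i.val + j.val + 1 = 2 then (1 : L) else 0)).Local v × (UnitaryGroup.cmDatum L 1 (Matrix.of fun i j : Fin 1 => if i.val + j.val + 1 = 1 then (1 : L) else 0)).Local v)),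
        HLengthTwoLabels L v
          (torusCharPair (conjLocal L (IsCMField.complexConj L) v) (cmLocalForm L 2 v) (cmLocalForm_eq_over L 2 v) 0
            ((torusLocalComponent L (IsCMField.complexConj L) v ξ.η).comp
                (quotConj (conjLocal L (IsCMField.complexConj L) v) (conjLocal_conjLocal_cm L v)) *
              halfModulusChar (UnitaryGroup.LocalRing L v))
            (torusLocalComponent L (IsCMField.complexConj L) v ξ.ψ))
          ((torusLocalComponent L (IsCMField.complexConj L) v ξ.ψ).comp (localDet (IsCMField.complexConj L) v (isUnit_antidiagOne_det L 1))) π₁ πSt →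
        (∀ fH : ((UnitaryGroup.cmDatum L 2 (Matrix.of fun i j : Fin 2 => if i.val + j.val + 1 = 2 then (1 : L) else 0)).Local v × (UnitaryGroup.cmDatum L 1 (Matrix.of fun i j : Fin 1 => if i.val + j.val + 1 = 1 then (1 : L) else 0)).Local v) → ℂ, IsLocSmooth fH → π₁.smoothTrace νHv fH = charDist (ξ.xiLocalChar v) νHv fH) →
      ∀ [MeasurableSpace (Gqs L v ⧸ Subgroup.center (Gqs L v))] [BorelSpace (Gqs L v ⧸ Subgroup.center (Gqs L v))]
        (μZ : Measure (Gqs L v ⧸ Subgroup.center (Gqs L v))) [μZ.IsHaarMeasure],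
      -- ══ the §12.5–12.6 DATUM on the model (★ TR carpet `Ch12Sec5Defs.EllipticData`, a BINDER — no instance) and its COMPATIBILITY with the organ's currency ══
      ∀ (𝔇 : Ch12Sec5.EllipticData (Gqs L v) ((UnitaryGroup.cmDatum L 2 (Matrix.of fun i j : Fin 2 => if i.val + j.val + 1 = 2 then (1 : L) else 0)).Local v × (UnitaryGroup.cmDatum L 1 (Matrix.of fun i j : Fin 1 => if i.val + j.val + 1 = 1 then (1 : L) else 0)).Local v)),
      𝔇.μG = νQv → 𝔇.μH = νHv → 𝔇.μGZ = μZ →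
      (∀ (φ : Gqs L v → ℂ) (fH : ((UnitaryGroup.cmDatum L 2 (Matrix.of fun i j : Fin 2 => if i.val + j.val + 1 = 2 then (1 : L) else 0)).Local v × (UnitaryGroup.cmDatum L 1 (Matrix.of fun i j : Fin 1 => if i.val + j.val + 1 = 1 then (1 : L) else 0)).Local v) → ℂ), 𝔇.IsTransfer φ fH ↔ IsLocalDeltaTransfer L (qsForm L) v ((finExplicitCollection L (qsForm L) μ (finExplicitDelta_conj_left_all L (qsForm L) μ) (finExplicitDelta_conj_right_all L (qsForm L) μ)) v) mHv mQv fH φ) →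
      ({πSt} : Finset (IrrClass ((UnitaryGroup.cmDatum L 2 (Matrix.of fun i j : Fin 2 => if i.val + j.val + 1 = 2 then (1 : L) else 0)).Local v × (UnitaryGroup.cmDatum L 1 (Matrix.of fun i j : Fin 1 => if i.val + j.val + 1 = 1 then (1 : L) else 0)).Local v))) ∈ 𝔇.sqPacketsH →
      -- ══ CARPET RELATIONS (named facts of ★ `Ch12Sec5` ∕ ★ `Ch12Sec6`, read at `𝔇`) ══
      𝔇.UpSpec → 𝔇.Prop1252 → Ch12Sec6.Prop1261a 𝔇 → Ch12Sec6.Prop1261b 𝔇 →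
      -- ══ PRINTED INPUTS NO CARPET STATES (datum-level; typer asks (M1)(M1H)(UPR)(DENS)(L2D)(ELL)(DET)(PIN)(M5)(DEF)(LDS)) ══
      (∀ π : IrrClass (Gqs L v), 𝔇.IsL2 π → Measurable (𝔇.char π) ∧ LocallyIntegrable (𝔇.char π) 𝔇.μG ∧
          (∀ x ∈ 𝔇.regG, ∀ᶠ y in 𝓝 x, 𝔇.char π y = 𝔇.char π x) ∧
          ∀ φ : Gqs L v → ℂ, IsLocSmooth φ → π.smoothTrace 𝔇.μG φ = ∫ x, φ x * 𝔇.char π x ∂𝔇.μG) →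
      (∀ ρ ∈ 𝔇.sqPacketsH, Measurable (𝔇.packetCharH ρ) ∧ LocallyIntegrable (𝔇.packetCharH ρ) 𝔇.μH ∧
          Ch12Sec5.IsStableClassFunOn 𝔇.stConjH 𝔇.regH (𝔇.packetCharH ρ) ∧ Ch12Sec5.IsStableClassFunOn 𝔇.stConjH 𝔇.ellH (𝔇.packetCharH ρ) ∧
          ∀ fH : ((UnitaryGroup.cmDatum L 2 (Matrix.of fun i j : Fin 2 => if i.val + j.val + 1 = 2 then (1 : L) else 0)).Local v × (UnitaryGroup.cmDatum L 1 (Matrix.of fun i j : Fin 1 => if i.val + j.val + 1 = 1 then (1 : L) else 0)).Local v) → ℂ, IsLocSmooth fH → (∑ σ ∈ ρ, σ.smoothTrace 𝔇.μH fH) = ∫ h, fH h * 𝔇.packetCharH ρ h ∂𝔇.μH) →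
      (∀ ρ ∈ 𝔇.sqPacketsH, LocallyIntegrable (𝔇.up (𝔇.packetCharH ρ)) 𝔇.μG ∧
          ∀ x ∈ 𝔇.regG, ∀ᶠ y in 𝓝 x, 𝔇.up (𝔇.packetCharH ρ) y = 𝔇.up (𝔇.packetCharH ρ) x) →
      (∀ F U : Gqs L v → ℂ, Measurable F → Measurable U → LocallyIntegrable F 𝔇.μG → LocallyIntegrable U 𝔇.μG →
          (∀ x ∈ 𝔇.regG, ∀ᶠ y in 𝓝 x, F y = F x) → (∀ x ∈ 𝔇.regG, ∀ᶠ y in 𝓝 x, U y = U x) →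
          (∀ φ : Gqs L v → ℂ, IsLocSmooth φ → ∫ x, φ x * F x ∂𝔇.μG = ∫ x, φ x * U x ∂𝔇.μG) →
          ∀ T ∈ 𝔇.cartanG, ∀ᵐ t : ↥T ∂(𝔇.μT T), F (t : Gqs L v) = U (t : Gqs L v)) →
      (∀ π : IrrClass (Gqs L v), 𝔇.IsL2 π → ∀ T ∈ 𝔇.cartanG, MemLp (fun t : ↥T => (𝔇.DG (t : Gqs L v) : ℂ) * 𝔇.char π (t : Gqs L v)) 2 (𝔇.μT T)) →
      (∀ π : IrrClass (Gqs L v), 𝔇.IsL2 π → 𝔇.IsEllipticRep π) →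
      (∀ ψ : ↥(Subgroup.center (Gqs L v)) →* ℂˣ, Continuous ψ → ¬ 𝔇.IsL2 (𝔇.detG ψ)) →
      (∀ ξ' : ((UnitaryGroup.cmDatum L 2 (Matrix.of fun i j : Fin 2 => if i.val + j.val + 1 = 2 then (1 : L) else 0)).Local v × (UnitaryGroup.cmDatum L 1 (Matrix.of fun i j : Fin 1 => if i.val + j.val + 1 = 1 then (1 : L) else 0)).Local v) →* ℂˣ, Continuous ξ' → ¬ 𝔇.IsL2 (𝔇.piN ξ')) →
      (∀ ρ ∈ 𝔇.sqPacketsH, 𝔇.innerH (𝔇.packetCharH ρ) (𝔇.packetCharH ρ) = (ρ.card : ℂ)) →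
      (∀ ρ ∈ 𝔇.sqPacketsH, 𝔇.InnerGDefined (𝔇.up (𝔇.packetCharH ρ)) (𝔇.up (𝔇.packetCharH ρ)) ∧ 𝔇.InnerHDefined (𝔇.packetCharH ρ) (𝔇.packetCharH ρ)) →
      (∀ P ∈ 𝔇.ldsPackets, ∀ σ ∈ P, ¬ 𝔇.IsL2 σ) →
      ∀ aX : IrrClass (Gqs L v) → ℤ,
        (∀ (fH : ((UnitaryGroup.cmDatum L 2 (Matrix.of fun i j : Fin 2 => if i.val + j.val + 1 = 2 then (1 : L) else 0)).Local v × (UnitaryGroup.cmDatum L 1 (Matrix.of fun i j : Fin 1 => if i.val + j.val + 1 = 1 then (1 : L) else 0)).Local v) → ℂ) (φ : Gqs L v → ℂ), IsLocSmooth fH → IsLocSmooth φ →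
            IsLocalDeltaTransfer L (qsForm L) v ((finExplicitCollection L (qsForm L) μ (finExplicitDelta_conj_left_all L (qsForm L) μ) (finExplicitDelta_conj_right_all L (qsForm L) μ)) v) mHv mQv fH φ →
            Summable (fun π : IrrClass (Gqs L v) => (aX π : ℂ) * π.smoothTrace νQv φ) ∧
              ∑' π : IrrClass (Gqs L v), (aX π : ℂ) * π.smoothTrace νQv φ = πSt.smoothTrace νHv fH) →
        (Function.support aX).Finite →
        (∀ π : IrrClass (Gqs L v), aX π ≠ 0 → π.IsSquareIntegrable μZ) →
        ∑ᶠ π : IrrClass (Gqs L v), aX π ^ 2 = 2 := by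
  intro L _ _ _ μ ξ v hns hμu hμω _ _ _ _ νHv νQv _ _ _ _ mHv mQv hcanH hcanQ hTv π₁ πSt hHL hπ₁ _ _ μZ _
    𝔇 hμG hμH hμGZ hTr hρ hUp h52 h61a h61b hHC hHCH hUpReg hDens hL2dom hEll hDet hPiN hM5 hDef hLds
    aX hid hfin hL2
  -- the organ's quotient σ-algebras, re-installed as local instances (the datum's instance slots are these)
  letI : ∀ a' : ((UnitaryGroup.cmDatum L 2 (Matrix.of fun i j : Fin 2 => if i.val + j.val + 1 = 2 then (1 : L) else 0)).Local v × (UnitaryGroup.cmDatum L 1 (Matrix.of fun i j : Fin 1 => if i.val + j.val + 1 = 1 then (1 : L) else 0)).Local v), MeasurableSpace (((UnitaryGroup.cmDatum L 2 (Matrix.of fun i j : Fin 2 => if i.val + j.val + 1 = 2 then (1 : L) else 0)).Local v × (UnitaryGroup.cmDatum L 1 (Matrix.of fun i j : Fin 1 => if i.val + j.val + 1 = 1 then (1 : L) else 0)).Local v) ⧸ Subgroup.centralizer ({a'} : Set ((UnitaryGroup.cmDatum L 2 (Matrix.of fun i j : Fin 2 => if i.val + j.val + 1 = 2 then (1 :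 L) else 0)).Local v × (UnitaryGroup.cmDatum L 1 (Matrix.of fun i j : Fin 1 => if i.val + j.val + 1 = 1 then (1 : L) else 0)).Local v))) := fun _ => borel _
  haveI : ∀ a' : ((UnitaryGroup.cmDatum L 2 (Matrix.of fun i j : Fin 2 => if i.val + j.val + 1 = 2 then (1 : L) else 0)).Local v × (UnitaryGroup.cmDatum L 1 (Matrix.of fun i j : Fin 1 => if i.val + j.val + 1 = 1 then (1 : L) else 0)).Local v), BorelSpace (((UnitaryGroup.cmDatum L 2 (Matrix.of fun i j : Fin 2 => if i.val + j.val + 1 = 2 then (1 : L) else 0)).Local v × (UnitaryGroup.cmDatum L 1 (Matrix.of fun i j : Fin 1 => if i.val + j.val + 1 = 1 then (1 : L) else 0)).Local v) ⧸ Subgroup.centralizer ({a'} : Set ((UnitaryGroup.cmDatum L 2 (Matrix.of fun i j : Fin 2 => if i.val + j.val + 1 = 2 then (1 : L) else 0)).Local v × (UnitaryGroup.cmDatum L 1 (Matrix.of fun i j : Fin 1 => if i.val + j.val + 1 = 1 then (1 : L) else 0)).Local v))) := fun _ => ⟨rfl⟩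
  letI : ∀ γ : Gqs L v, MeasurableSpace (Gqs L v ⧸ Subgroup.centralizer ({γ} : Set (Gqs L v))) := fun _ => borel _
  haveI : ∀ γ : Gqs L v, BorelSpace (Gqs L v ⧸ Subgroup.centralizer ({γ} : Set (Gqs L v))) := fun _ => ⟨rfl⟩
  refine stEllipticNormTwo_of_carpet L μ ξ v hns hμu hμω νHv νQv mHv mQv hcanH hcanQ hTv π₁ πSt hHL hπ₁ μZ
    𝔇 hμG hμH hμGZ hTr hρ hUp h52 h61a h61b hHC hHCH hUpReg hDens hL2dom hEll hDet hPiN hM5 hDef aX hid hfin hL2 ?_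
  -- (B) from «members are L²» + (LDS)
  intro P hP π hπ π' _ _
  by_cases h0 : aX π = 0
  · exact Or.inl h0
  · refine absurd ?_ (hLds P hP π hπ)
    show IrrClass.IsSquareIntegrable 𝔇.μGZ π
    rw [hμGZ]
    exact hL2 π h0

end Summit.HodgeConjecture.HodgeConjecture.Cruxes.H413.F0P3cStCharTSEllCompose
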